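import Literature.NumberTheory.GaloisRepresentations.LubinTateNormGroup
import Literature.NumberTheory.GaloisRepresentations.LocalReciprocityThetaProofs
import HarnessLib

/-!
# Local class field theory from the finite-level reciprocity systems alone

Bookkeeping for the three named facts of `LocalClassFieldTheory.lean` (`nonempty_localArtinData`,
`exists_isCompatible`, `exists_intermediateField_normSubgroup_eq`).  `LocalReciprocityThetaProofs.lean`
reduced the first two to the finite-level reciprocity systems `exists_isReciprocitySystem(_normCompatible)`
(Serre, *Local Fields*, XIII §4; `LocalReciprocityFinite.lean`) **plus** two norm-group inputs: norm groups
are closed (proved there, `isClosed_of_isNormSubgroup_holds`) and the universal norm group is trivial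
(Serre XIV §6 Cor. 2 (i)), the latter obtained from the Lubin–Tate norm-group fact
`exists_abelian_norm_le_lubinTate`.  With `LubinTateNormGroup.lean` both that fact
(`exists_abelian_norm_le_lubinTate_holds`) and, unconditionally, `universalNormSubgroup_eq_bot` are
theorems, so:

* `exists_isLocalReciprocityMap_of_exists_isReciprocitySystem` — the reciprocity map `θ_F : Fˣ → Γ_F^ab`
  with its printed properties from `exists_isReciprocitySystem F` alone;
* `nonempty_localArtinData_of_exists_isReciprocitySystem`,
  `exists_isCompatible_of_exists_isReciprocitySystem_normCompatible` — the two Artin-map facts from the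
  finite-level systems alone;
* `localExistenceTheorem_of_exists_isReciprocitySystem`,
  `exists_intermediateField_normSubgroup_eq_of_exists_isReciprocitySystem` — the existence theorem
  (Serre XIV §6 Thm. 1) from `exists_isReciprocitySystem F` alone.

The remaining input of the whole cluster is thus the finite-level local reciprocity law (Serre XIII §4:
`Fˣ/N(Eˣ) ≅ G(E/F)` for finite abelian `E/F`, compatibly in towers, units onto inertia, uniformisers to
Frobenius on unramified levels), being pursued through Neukirch's abstract class field theory
(`AbstractClassFieldTheory.lean` ff.).

## References

* J.-P. Serre, *Local Fields* (1979), Ch. XIII §4, Ch. XIV §6 Thm. 1, Cor. 2, Remark 2.  [SerreLocalFields1979]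
* J.-P. Serre, *Local class field theory*, Ch. VI of Cassels–Fröhlich (1967), §2.4, §3.8.  [CasselsFrohlichANT1967]
-/

noncomputable section

open ValuativeRel

namespace Literature.NumberTheory.GaloisRepresentations
section FromReciprocitySystem

universe u v

variable (F : Type u) [Field F] [ValuativeRel F] [TopologicalSpace F] [IsNonarchimedeanLocalField F]

/-- **The reciprocity map `θ_F : Fˣ → Γ_F^ab` from a finite-level reciprocity system alone** (the fact
`exists_isLocalReciprocityMap F` of `LocalReciprocity.lean`): the norm-group inputs of
`exists_isLocalReciprocityMap_of_isReciprocitySystem` — norm groups are closed and the universal norm group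
is trivial — are now theorems (`isClosed_of_isNormSubgroup_holds`, `universalNormSubgroup_eq_bot`).
Ref: Serre, *Local Fields* (1979), Ch. XIII §4; Ch. XIV §6 Cor. 2, Remark 2. [folklore] -/
theorem exists_isLocalReciprocityMap_of_exists_isReciprocitySystem (h : exists_isReciprocitySystem F) :
    exists_isLocalReciprocityMap F :=
  exists_isLocalReciprocityMap_of_isReciprocitySystem h (universalNormSubgroup_eq_bot F)

/-- **`nonempty_localArtinData` from the finite-level reciprocity systems alone** (for all
non-archimedean local fields of one universe).
Ref: Serre, *Local Fields* (1979), Ch. XIII §4, Ch. XIV §6; Tate, Corvallis 1979, (1.4.1). [folklore] -/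
theorem nonempty_localArtinData_of_exists_isReciprocitySystem
    (h : ∀ (F : Type u) [Field F] [ValuativeRel F] [TopologicalSpace F] [IsNonarchimedeanLocalField F],
      exists_isReciprocitySystem F) : nonempty_localArtinData.{u} :=
  nonempty_localArtinData_of_lcft fun F _ _ _ _ =>
    exists_isLocalReciprocityMap_of_exists_isReciprocitySystem F (h F)

variable {F} in
/-- **`exists_isCompatible` (norm functoriality of the local Artin map) from the finite-level reciprocity
systems alone**: the pair facts `exists_isReciprocitySystem_normCompatible F E` (Serre XIII §4 Prop. 10 /
Cassels–Fröhlich VI §2.4, finite level) for the finite extensions `E/F` suffice — the universal norm groups of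
`F` and of every `E` are trivial by `universalNormSubgroup_eq_bot`.
Ref: Serre, *Local Fields* (1979), Ch. XIII §4 Prop. 10, Ch. XIV §6 Cor. 2; Cassels–Fröhlich (1967) Ch. VI
§2.4. [folklore] -/
theorem exists_isCompatible_of_exists_isReciprocitySystem_normCompatible
    (hrec : ∀ (E : Type v) [Field E] [ValuativeRel E] [TopologicalSpace E]
      [IsNonarchimedeanLocalField E] [Algebra F E] [FiniteDimensional F E] [ValuativeExtension F E],
      exists_isReciprocitySystem_normCompatible F E) :
    exists_isCompatible.{u, v} F :=
  exists_isCompatible_of_isReciprocitySystem (universalNormSubgroup_eq_bot F) hrec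
    fun E _ _ _ _ _ _ _ => universalNormSubgroup_eq_bot E

/-- **The existence theorem from a finite-level reciprocity system alone** (Serre XIV §6 Thm. 1 from
XIII §4): `localExistenceTheorem F`. [cite: SerreLocalFields1979, Ch. XIV §6 Thm. 1] -/
theorem localExistenceTheorem_of_exists_isReciprocitySystem (h : exists_isReciprocitySystem F) :
    localExistenceTheorem F :=
  localExistenceTheorem_of_localReciprocityLaw F (localReciprocityLaw_of_exists_isReciprocitySystem h)

/-- The trunk predicate `exists_intermediateField_normSubgroup_eq F` (for a non-archimedean local field `F`)
from a finite-level reciprocity system alone. [cite: SerreLocalFields1979, Ch. XIV §6 Thm. 1] -/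
theorem exists_intermediateField_normSubgroup_eq_of_exists_isReciprocitySystem
    (h : exists_isReciprocitySystem F) : exists_intermediateField_normSubgroup_eq F :=
  localExistenceTheorem_of_exists_isReciprocitySystem F h

end FromReciprocitySystem

end Literature.NumberTheory.GaloisRepresentations
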